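import Mathlib
import HarnessLib
import Summits.ValiantsHypothesis.ValiantsHypothesis.Theses.MonotoneRestoration
import Literature.Computability.AlgebraicComplexity.SymmetricCircuitSubstitution
import Literature.Computability.AlgebraicComplexity.SymmetricCircuitPairing
import Literature.Computability.AlgebraicComplexity.TrivialAction
import Literature.Computability.AlgebraicComplexity.ArithCircuitProofs
import Summits.ValiantsHypothesis.ValiantsHypothesis.Theorems.MonotoneRestorationMonotoneRestorationQPZetaMatrix
import Summits.ValiantsHypothesis.ValiantsHypothesis.Theorems.MonotoneRestorationMonotoneRestorationQPZetaHomogeneous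
import Summits.ValiantsHypothesis.ValiantsHypothesis.Theorems.MonotoneRestorationMonotoneRestorationQPLabelledOfArithCircuit

/-! # Route MonotoneRestoration — crux `MonotoneRestorationQP`, line Sketch v10: THEOREM ζ-G
(stmt-ValiantsHypothesis-15886, lead c5)

**Ordinary programs on top of symmetrically computed INVARIANT generators are symmetric circuits.**
Part of THEOREM ζ (the SIZE CALCULUS of Dawar–Wilsenach square-symmetric circuits). If
`g_1, …, g_m` are `Γ`-INVARIANT polynomials, each computed by a `Γ`-symmetric single-output
circuit on `≤ t` gates, and `F(y_1, …, y_m)` is ANY polynomial computed by an ordinary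
straight-line program (tree `ArithCircuit`, the currency of `complexity` and `IsVPFamily`) of size
`s` and fan-in `≤ A`, then `F(g_1, …, g_m)` is computed by a `Γ`-symmetric circuit on at most
`m t + 6 (s + 1)(A + 1) + m` gates: the generator circuits are paired into one circuit with
outputs indexed by the trivially-acted index type `TrivAct (Fin m)` (`zeta_symmetric_family`), the
program becomes a labelled circuit over `TrivAct (Fin m)` (Z12, `stub_labelled_of_arithCircuit`,
symmetric for every group because the action on its variables is trivial,
`zeta_isSymmetric_of_trivial`), and the two are composed by substitution (Z1).

* `qpSymmetric_of_invariantGenerators` — COROLLARY AT THE CRUX'S SCALE (registered): a family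
  presented, for every `n`, as `F_n(g_{n,1}, …, g_{n,m_n})` with `m_n`, the symmetric sizes of the
  invariant generators `g_{n,i}` and `complexity F_n` all quasi-polynomial has square-symmetric
  circuits of quasi-polynomial size. This is census S10's "`S⁺⁺ ⟹ crux`" made unconditional and
  freed from homomorphism polynomials: ANY symmetric-cheap invariant generating family will do
  (power sums `Σ_ij x_ij^k`, traces `tr((XXᵀ)^k)`, determinants of equivariant matrix circuits —
  THEOREM ζ-M —, orbit sums, hom polynomials once defined). In particular the Bläser–Jindal
  regime (polynomials symmetric in ALL `n²` entries: `F_n ∈ VP` by BJ19, generators the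
  elementary symmetric polynomials of the entries) restores at polynomial cost; what the crux adds
  beyond ζ-G is exactly the passage from the matrix-symmetric invariant RING (not finitely
  generated in the required sense, census T1/S9) to generators — i.e. the choice of generators is
  the whole difficulty.
-/

noncomputable section

-- `Summit.ValiantsHypothesis.ValiantsHypothesis.…` is the tree's mandated namespace (Sub = Summit).
set_option linter.dupNamespace false

namespace Summit.ValiantsHypothesis.ValiantsHypothesis.Theorems

open Literature.Computability.AlgebraicComplexity

/-! ### Circuits over trivially acted variables are symmetric -/

/-- **A labelled circuit whose variables and output indices are fixed by `Γ` is `Γ`-symmetric**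
(the identity is an automorphism extending every `γ`). [folklore] -/
theorem zeta_isSymmetric_of_trivial {K X Y G Γ : Type} [Group Γ] [MulAction Γ X] [MulAction Γ Y]
    (C : LabelledArithCircuit K X Y G) (hX : ∀ (γ : Γ) (x : X), γ • x = x)
    (hY : ∀ (γ : Γ) (y : Y), γ • y = y) : C.IsSymmetric Γ := by
  intro γ
  refine ⟨1, ⟨fun g => ?_, fun g => ?_, fun y => ?_⟩⟩
  · change C.children g = (C.children g).map (Equiv.refl G).toEmbedding
    rw [Equiv.refl_toEmbedding, Finset.map_refl]
  · change C.label g = γ • C.label g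
    rcases C.label g with x | c | _ | _
    · rw [CircuitLabel.smul_var, hX]
    · rw [CircuitLabel.smul_const]
    · rw [CircuitLabel.smul_add]
    · rw [CircuitLabel.smul_mul]
  · rw [hY]; rfl

/-! ### One circuit for a family of symmetrically computed invariants -/

/-- **ζ-G1 — a family of `Γ`-symmetric single-output circuits is ONE `Γ`-symmetric circuit** with
outputs indexed by `TrivAct (Fin m)` (iterated pairing; the output gates of single-output symmetric
circuits are fixed by every automorphism, which is what the trivial action on the index type
records), on at most `m t` gates if each member has `≤ t` gates. [folklore] -/
theorem zeta_symmetric_family {K X Γ : Type} [CommSemiring K] [Group Γ] [MulAction Γ X]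
    [MulAction Γ Unit] (t : ℕ) :
    ∀ (m : ℕ) (g : Fin m → MvPolynomial X K),
      (∀ i, ∃ (G : Type) (_ : Fintype G) (C : LabelledArithCircuit K X Unit G),
        C.IsSymmetric Γ ∧ C.eval (C.output ()) = g i ∧ Fintype.card G ≤ t) →
      ∃ (G : Type) (_ : Fintype G) (C : LabelledArithCircuit K X (TrivAct (Fin m)) G),
        C.IsSymmetric Γ ∧ (∀ i, C.eval (C.output (TrivAct.wrap i)) = g i) ∧
          Fintype.card G ≤ m * t := by
  intro m
  induction m with
  | zero =>
    intro g _
    refine ⟨PEmpty, inferInstance,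
      { children := fun e => e.elim, label := fun e => e.elim,
        output := fun i => (TrivAct.unwrap i).elim0, wf := ⟨fun e => e.elim⟩,
        isInput_iff := fun e => e.elim, eq_of_label_eq := fun e => e.elim,
        output_injective := fun i => (TrivAct.unwrap i).elim0 }, ?_, fun i => i.elim0, by simp⟩
    intro γ
    exact ⟨1, ⟨fun e => e.elim, fun e => e.elim, fun i => (TrivAct.unwrap i).elim0⟩⟩
  | succ m ih =>
    intro g hg
    obtain ⟨Gm, im, Cm, hm, hevm, hcm⟩ := ih (fun i => g (Fin.castSucc i)) fun i => hg _
    obtain ⟨Gl, il, Cl, hl, hevl, hcl⟩ := hg (Fin.last m)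
    obtain ⟨G₀, i₀, C₀, h₀, hinl, hinr, hc₀⟩ := hm.exists_pairing hl
    -- re-index the outputs `TrivAct (Fin m) ⊕ Unit` along `Fin (m+1)`
    let e₀ : Fin (m + 1) → TrivAct (Fin m) ⊕ Unit :=
      Fin.lastCases (Sum.inr ()) (fun j => Sum.inl (TrivAct.wrap j))
    have he₀_last : e₀ (Fin.last m) = Sum.inr () := by
      simp only [e₀, Fin.lastCases_last]
    have he₀_cast : ∀ j : Fin m, e₀ (Fin.castSucc j) = Sum.inl (TrivAct.wrap j) := by
      intro j; simp only [e₀, Fin.lastCases_castSucc]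
    have he₀_inj : Function.Injective e₀ := by
      intro a b hab
      rcases Fin.eq_castSucc_or_eq_last a with ⟨ja, rfl⟩ | rfl <;>
        rcases Fin.eq_castSucc_or_eq_last b with ⟨jb, rfl⟩ | rfl
      · rw [he₀_cast, he₀_cast] at hab
        have := TrivAct.wrap_injective (Sum.inl_injective hab)
        rw [this]
      · rw [he₀_cast, he₀_last] at hab; cases hab
      · rw [he₀_last, he₀_cast] at hab; cases hab
      · rfl
    let e : TrivAct (Fin (m + 1)) → TrivAct (Fin m) ⊕ Unit := fun i => e₀ (TrivAct.unwrap i)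
    have he_inj : Function.Injective e := fun a b hab =>
      TrivAct.unwrap_injective (he₀_inj hab)
    have hequiv : ∀ (γ : Γ) (i : TrivAct (Fin (m + 1))), e (γ • i) = γ • e i := by
      intro γ i
      rw [TrivAct.smul_def]
      rcases h : e i with w | u
      · rw [Sum.smul_inl, TrivAct.smul_def]
      · rw [Sum.smul_inr]
    obtain ⟨C', h', hev'⟩ := zeta_symmetric_reindex C₀ h₀ e he_inj hequiv
    refine ⟨G₀, i₀, C', h', fun i => ?_, ?_⟩
    · rw [hev']
      change C₀.eval (C₀.output (e₀ (TrivAct.unwrap (TrivAct.wrap i)))) = g i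
      rw [TrivAct.unwrap_wrap]
      rcases Fin.eq_castSucc_or_eq_last i with ⟨j, rfl⟩ | rfl
      · rw [he₀_cast, hinl, hevm]
      · rw [he₀_last, hinr, hevl]
    · calc Fintype.card G₀ ≤ Fintype.card Gm + Fintype.card Gl := hc₀
        _ ≤ m * t + t := Nat.add_le_add hcm hcl
        _ = (m + 1) * t := (Nat.succ_mul m t).symm

/-! ### THEOREM ζ-G -/

/-- **THEOREM ζ-G — PROGRAMS ON INVARIANT GENERATORS ARE SYMMETRIC CIRCUITS.** Let
`g_0, …, g_{m-1}` be polynomials over a `Γ`-set of variables `X`, each computed by a `Γ`-symmetric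
single-output circuit on `≤ t` gates (so each `g_i` is `Γ`-invariant), and let `P` be an ordinary
straight-line program (tree `ArithCircuit`) in `m` variables of size `s` and fan-in `≤ A`. Then
`P(g_0, …, g_{m-1})` (`MvPolynomial.aeval g P.eval`) is computed by a `Γ`-symmetric circuit on at
most `m t + 6 (s + 1)(A + 1) + m` gates (ζ-G1, the bridge Z12 over `TrivAct (Fin m)`, and
substitution Z1). [folklore] -/
theorem zeta_symmetric_of_invariantGenerators {K X Γ : Type} [CommSemiring K] [Group Γ]
    [MulAction Γ X] [MulAction Γ Unit] {m : ℕ} (g : Fin m → MvPolynomial X K) (t : ℕ)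
    (hg : ∀ i, ∃ (G : Type) (_ : Fintype G) (C : LabelledArithCircuit K X Unit G),
      C.IsSymmetric Γ ∧ C.eval (C.output ()) = g i ∧ Fintype.card G ≤ t)
    (P : ArithCircuit K (Fin m)) (A : ℕ) (hA : ∀ gate ∈ P.gates, gate.fanIn ≤ A) :
    ∃ (G : Type) (_ : Fintype G) (C : LabelledArithCircuit K X Unit G),
      C.IsSymmetric Γ ∧ C.eval (C.output ()) = MvPolynomial.aeval g P.eval ∧
        Fintype.card G ≤ m * t + 6 * (P.size + 1) * (A + 1) + m := by
  obtain ⟨G₁, i₁, C₁, h₁, hev₁, hc₁⟩ := zeta_symmetric_family t m g hg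
  obtain ⟨G₂, i₂, C₂, hev₂, hc₂⟩ := stub_labelled_of_arithCircuit P A hA
  have h₂ : C₂.IsSymmetric Γ :=
    zeta_isSymmetric_of_trivial C₂ (fun γ x => TrivAct.smul_def γ x) (fun γ y => rfl)
  obtain ⟨G, inst, C, hC, hev, hc⟩ := h₁.exists_substitution h₂
  refine ⟨G, inst, C, hC, ?_, ?_⟩
  · rw [hev (), hev₂, MvPolynomial.aeval_rename]
    have hfun : (fun x' => C₁.eval (C₁.output x')) ∘ TrivAct.wrap = g := funext fun i => hev₁ i
    rw [hfun]
  · calc Fintype.card G ≤ Fintype.card G₁ + Fintype.card G₂ := hc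
      _ ≤ m * t + (6 * (P.size + 1) * (A + 1) + Fintype.card (Fin m)) :=
          Nat.add_le_add hc₁ hc₂
      _ = m * t + 6 * (P.size + 1) * (A + 1) + m := by
          rw [Fintype.card_fin]; ring

/-- **ζ-G with `complexity`.** The same with the program measured by the tree's fan-in-two
`complexity`: `F(g)` has a `Γ`-symmetric circuit on at most `m t + 18 (complexity F + 1) + m`
gates. [folklore] -/
theorem zeta_symmetric_of_invariantGenerators_complexity {K X Γ : Type} [CommSemiring K]
    [Group Γ] [MulAction Γ X] [MulAction Γ Unit] {m : ℕ} (g : Fin m → MvPolynomial X K) (t : ℕ)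
    (hg : ∀ i, ∃ (G : Type) (_ : Fintype G) (C : LabelledArithCircuit K X Unit G),
      C.IsSymmetric Γ ∧ C.eval (C.output ()) = g i ∧ Fintype.card G ≤ t)
    (F : MvPolynomial (Fin m) K) :
    ∃ (G : Type) (_ : Fintype G) (C : LabelledArithCircuit K X Unit G),
      C.IsSymmetric Γ ∧ C.eval (C.output ()) = MvPolynomial.aeval g F ∧
        Fintype.card G ≤ m * t + 18 * (complexity F + 1) + m := by
  obtain ⟨P, h2, hP, hsize⟩ := ArithCircuit.exists_computes_size_eq_complexity F
  obtain ⟨G, inst, C, hC, hev, hc⟩ := zeta_symmetric_of_invariantGenerators g t hg P 2 h2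
  refine ⟨G, inst, C, hC, by rw [hev, hP], hc.trans ?_⟩
  rw [hsize]; ring_nf; omega

/-! ### The corollary at the crux's scale -/

/-- **COROLLARY ζ-G (crux scale) — INVARIANT-GENERATOR PRESENTATIONS RESTORE AT QUASI-POLYNOMIAL
COST.** If a family `f_n ∈ ℂ[x_ij : i, j < n]` is presented, for every `n`, as
`F_n(g_{n,0}, …, g_{n,m_n - 1})` where `m_n ≤ 2^{(log₂ n + c)^c}`, every generator `g_{n,i}` has a
square-symmetric circuit of size `≤ 2^{(log₂ n + c)^c}` (so is invariant under the diagonal action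
of `Sym(Fin n)`), and `complexity F_n ≤ 2^{(log₂ n + c)^c}`, then `f_n` has square-symmetric
circuits of quasi-polynomial size — the conclusion of `MonotoneRestorationQP` / of complex
matrix-symmetric restoration holds for `f`. (Census S10: "`S⁺⁺ ⟹ crux`", for ARBITRARY
symmetric-cheap invariant generators; the Bläser–Jindal fully-symmetric regime is the instance
`g` = power sums of all entries.) [folklore] -/
theorem qpSymmetric_of_invariantGenerators :
    ∀ (f : (n : ℕ) → MvPolynomial (Fin n × Fin n) ℂ),
      (∃ c : ℕ, ∀ n : ℕ, ∃ (m : ℕ) (g : Fin m → MvPolynomial (Fin n × Fin n) ℂ)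
        (F : MvPolynomial (Fin m) ℂ),
        m ≤ 2 ^ ((Nat.log 2 n + c) ^ c) ∧
        (∀ i, ∃ (G : Type) (_ : Fintype G) (C : LabelledArithCircuit ℂ (Fin n × Fin n) Unit G),
          C.IsSymmetric (Equiv.Perm (Fin n)) ∧ C.eval (C.output ()) = g i ∧
            Fintype.card G ≤ 2 ^ ((Nat.log 2 n + c) ^ c)) ∧
        complexity F ≤ 2 ^ ((Nat.log 2 n + c) ^ c) ∧
        MvPolynomial.aeval g F = f n) →
      ∃ c : ℕ, ∀ n : ℕ, ∃ (G : Type) (_ : Fintype G)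
        (C : LabelledArithCircuit ℂ (Fin n × Fin n) Unit G),
        C.IsSymmetric (Equiv.Perm (Fin n)) ∧ C.eval (C.output ()) = f n ∧
          Fintype.card G ≤ 2 ^ ((Nat.log 2 n + c) ^ c) := by
  intro f hf
  obtain ⟨c, hc⟩ := hf
  obtain ⟨c₃, hc₃⟩ := zeta_poly_mul_qp_le 38 0 c 2
  refine ⟨c₃, fun n => ?_⟩
  obtain ⟨m, g, F, hm, hg, hF, hev⟩ := hc n
  set Q := 2 ^ ((Nat.log 2 n + c) ^ c) with hQ
  obtain ⟨G, inst, C, hC, hevC, hcard⟩ :=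
    zeta_symmetric_of_invariantGenerators_complexity (Γ := Equiv.Perm (Fin n)) g Q hg F
  refine ⟨G, inst, C, hC, by rw [hevC, hev], hcard.trans (le_trans ?_ (hc₃ n))⟩
  have hQ1 : 1 ≤ Q := Nat.one_le_two_pow
  have h2 : 2 ^ (2 * (Nat.log 2 n + c) ^ c) = Q * Q := by rw [two_mul, pow_add]
  rw [pow_zero, mul_one, h2]
  calc m * Q + 18 * (complexity F + 1) + m ≤ Q * Q + 18 * (Q + 1) + Q := by
        have := Nat.mul_le_mul_right Q hm
        omega
    _ ≤ 38 * (Q * Q) := by nlinarith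

end Summit.ValiantsHypothesis.ValiantsHypothesis.Theorems

end
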